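import Summits.Ventures.HodgeRepro.Tier4.Line1.C7LocalFibration
import Summits.Ventures.HodgeRepro.Tier4.Line1.C7IntegralTransitive

/-!
# Tier4/Line1/C7Closed — LINE L1: C7, THE FIBRATION OVER THE STABILISER, UNCONDITIONAL

Blind re-derivation cell `pub-hodge-repro`, Tier 4 (README §9–§10), seat t4-L1-p4 (g2), LINE L1, rung C7 of the R-c cut
(typed census proofs/t4/L1/C7-rungs-sig.lean L257–L266, the closing line of the census).  Every rung of the census is now a
theorem in the tree: C7.1 / C7.1∞ (C7LocalFibration p675011: t4-L1-p1's open-mapping fibration + t4-L1-p2's consumer +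
the field-generic local Witt theorem, LocalWitt p674173 / LocalWittPlace p674648), C7.2 (t4-L1-p1 g2's integral Witt at
almost all finite places, `exists_finset_integral_transitive` — IntegralWitt p675010 / IntegralWittIsometry /
C7IntegralTransitive), C7.3a–d (C7CompactBox p673043, C7BoxCompact p672741, C7Reconstruct p673045, C7Components
p672122) and the assembly C7.4 (C7Assembly p672987).  This module composes them BY NAME into the census statement of C7,
VERBATIM, with no hypothesis beyond `IsGenuineRow W` and `IsDefinite W` (R1: the junk test of the census §0 is why these
two are binders).  No printed input enters C7 anywhere.

Nothing here says anything about the status of the Hodge conjecture for CM abelian varieties, which is NOT proved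
(HC_CM is NOT proved by anyone in this repository).
-/

set_option autoImplicit false

noncomputable section

namespace Summit.Ventures.HodgeRepro.Tier4.Line1

open NumberField IsDedekindDomain HeightOneSpectrum Topology Summit.Ventures.HodgeRepro.Tier4.Common Matrix

section C7Closed

variable {k : Type} [Field k] [NumberField k] (W : PlaneData k)

/-- **(C7) THE FIBRATION OVER THE STABILISER — UNCONDITIONAL** (census L257–L266 verbatim): for a genuine definite
plane, a non-zero rational row vector `v₀` and a compact `C₀ ⊆ 𝔸_k⁴`, there is a compact `K ⊆ U(W)(𝔸_k)` such that every
`g` with `v₀ g ∈ C₀` factors as `g = s κ` with `s` fixing `v₀` and `κ ∈ K`.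
`= exists_compact_stab_mul_of_integral` (C7 modulo C7.2) with C7.2 `exists_finset_integral_transitive` supplied by name. -/
theorem exists_compact_stab_mul_genuine (hg : IsGenuineRow W) (hW : IsDefinite W)
    (v₀ : Fin 4 → k) (hv₀ : v₀ ≠ 0) {C₀ : Set (Fin 4 → Ad k)} (hC₀ : IsCompact C₀) :
    ∃ K : Set (GA W), IsCompact K ∧ ∀ g : GA W,
      (fun i => algebraMap k (Ad k) (v₀ i)) ᵥ* GA.mat W g ∈ C₀ →
        ∃ s : GA W, (fun i => algebraMap k (Ad k) (v₀ i)) ᵥ* GA.mat W s =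
          (fun i => algebraMap k (Ad k) (v₀ i)) ∧ ∃ κ ∈ K, g = s * κ :=
  exists_compact_stab_mul_of_integral W hg hW
    (fun v₀ hv₀ => exists_finset_integral_transitive W hg hW v₀ hv₀) v₀ hv₀ hC₀

end C7Closed

end Summit.Ventures.HodgeRepro.Tier4.Line1

end
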